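import Summits.QuantumFields.BalabanUV.T4Continuum.Support.NE7K1LinBoxThm19HolderStep

/-!
# NE7K1LinBoxThm19Holder — row NE7 (node U5), candidate route HOM, path H1L, cell K1-lin(s): card §3y STEP 7, PART 11 —
# B4 THEOREM (1.9), THE HÖLDER CLAUSE, FOR THE TWO-CUTOFF LINE ON NEUMANN BOXES AT `A = 0`, EVERY SCALE `k ≥ 1`, EVERY `s ∈ [0,1]`,
# EVERY `0 ≤ α < 1`: `Σ_z (η|x′−x|)^{−α}|η^{−1}dd G^Π_k(s)(z)|·e^{δ₀dist({x,x′},z)} ≤ c₀`, `(c₀, δ₀)` IN `(d, L, α, a±)` ONLY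

Lineage `b2b-balaban-t4-ne7-p2` (CRUX PROVER NE7 #2), generation 79; file 104.  b04's `B4Thm19ZeroBoxHolder` §5–§6 re-run on the line's
tower (files 95–103): the induction over `j` for the Hölder-weighted doubly differenced rows (base = file 95's `boxLine_L_inv_decay`
differenced crudely; step = file 103's `step_termH_bound_line`; the geometric series `Σ_j (L^{−(k−j)})^{1−α}` of [B4] (2.39)), then the
two-centre weighted-row HÖLDER CLAUSE for `G^Π_k(s) = (boxLine(L^k, M, a_k, s))⁻¹`.

* §1 **`GfineL_rowwH_bound`**; §2 **`thm19_line_box_holder_roww`**.  The printed forms and (1.9)–(1.10) together are file 105.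
CONSTANTS: `(δ₀, c₀)` existential, closed terms in `(d, ℓ, α, a₋, a₊)` — NO `s`, `k`, box, `μ` ((k1)); `s` enters only through `0 ≤ s ≤ 1`.

HONEST FRAMING: [folklore]; A = 0; the LINE is not in [B4] — the print's box route transposed; nothing of Bałaban's asserted; no
`sorry`.  Census only (STEP 7, Hölder clause); NE7 NOT PRINTED ∕ NOT PROVED; spine 0∕9; FIXED FINITE T⁴, rung (B)+1; NOT infinite
volume, NOT mass gap, NOT Clay.  HONEST DEPENDENCY: continuum YM on T⁴ ⇐ BetaPertH ∧ nine spine estimates (0/9 proved); BetaPertH ⇐ (D1) ∧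
(D4) ∧ CAP+tail; G-an2-4 gates asym, D1 and NE2/3/4.
-/

noncomputable section

open Finset Matrix

namespace Summit.QuantumFields.BalabanUV.T4Continuum.NE7K1LinBoxThm19Holder

open Literature.MathematicalPhysics.QuantumFieldTheory.Balaban1983to89
open Literature.MathematicalPhysics.QuantumFieldTheory.Balaban1983to89.B4Reflection242
open Literature.MathematicalPhysics.QuantumFieldTheory.Balaban1983to89.B4Lower18
open Literature.MathematicalPhysics.QuantumFieldTheory.Balaban1983to89.B4ContourShift (supNorm supNorm_nonneg)
open Literature.MathematicalPhysics.QuantumFieldTheory.Balaban1983to89.B4BoxCov237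
open Literature.MathematicalPhysics.QuantumFieldTheory.Balaban1983to89.B4Thm110ZeroBox
open Literature.MathematicalPhysics.QuantumFieldTheory.Balaban1983to89.B4Thm110ZeroBoxDeriv
open Literature.MathematicalPhysics.QuantumFieldTheory.Balaban1983to89.B4Thm19ZeroBoxHolder
open Literature.MathematicalPhysics.QuantumFieldTheory.Balaban1983to89.B4StripSumsHolder (one_le_supNorm)
open Literature.MathematicalPhysics.QuantumFieldTheory.Balaban1983to89.B4Sect5Proof (latticeConst latticeConst_nonneg latticeSum_le)
open NE7K1LinSchurLineU1 NE7K1LinSchurFoldBox NE7K1LinBoxCovEnergy NE7K1LinLineLaplacian NE7K1LinBoxCov237 NE7K1LinBoxScales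
open NE7K1LinBoxRGStep NE7K1LinBoxThm110Step NE7K1LinBoxHolderRow NE7K1LinBoxThm19HolderStep

variable {d : ℕ}

/-! ### §1 The induction over `j`: the geometric sum `Σ_j (L^jη)^{1−α}` of [B4] (2.39) -/

set_option maxHeartbeats 1600000 in
/-- **UNIFORM TWO-CENTRE WEIGHTED BOUND FOR THE HÖLDER-DIFFERENCED ROWS OF ALL THE LINE's PROPAGATORS `𝒢_j(s)`, `1 ≤ j ≤ k`**:
for `0 ≤ α < 1` there are `δ₀ > 0`, `c₀ > 0` (depending on `d, ℓ, α` and the window `[a₋,a₊]` only) with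
`Σ_z (L^k/|x′−x|_∞)^α·L^k·|(𝒢_j(x′+e_μ,z) − 𝒢_j(x′,z)) − (𝒢_j(x+e_μ,z) − 𝒢_j(x,z))|·e^{δ₀min(|x−z|,|x′−z|)/L^k} ≤ c₀` for every box,
every `k ≥ 1`, every `1 ≤ j ≤ k`, EVERY `s ∈ [0,1]`, every axis `μ` and all `x ≠ x′` of the fine box — induction over `j` from the base
(file 95's one-step box line, doubly differenced crudely; b04's `Lk_sq_mul_sc_one_sq_inv`, `holderWeight_le`) with the steps of file
103, summed by the geometric series `Σ_{j<k}(L^{-(k-j)})^{1−α}` of [B4] (2.39) (b04's `sc_rpow_mul_inv_succ`, `Lratio_lt_one`);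
b04's `Gfine_rowwH_bound` re-run. [folklore] -/
theorem GfineL_rowwH_bound (d ℓ : ℕ) (hℓ : 1 ≤ ℓ) (amin aplus : ℝ) (ha : 0 < amin) {α : ℝ}
    (hα0 : 0 ≤ α) (hα1 : α < 1) :
    ∃ δ₀ c₀ : ℝ, 0 < δ₀ ∧ 0 < c₀ ∧ ∀ (k : ℕ), 1 ≤ k → ∀ (j : ℕ), 1 ≤ j → j ≤ k →
      ∀ (a s : ℝ), amin ≤ a → a ≤ aplus → 0 ≤ s → s ≤ 1 → ∀ (M : Fin (d + 1) → ℕ),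
        (∀ i, 1 ≤ M i) → ∀ (μ : Fin (d + 1)) (x xe x' xe' : ↥(boxDom (Nf ℓ k M))),
          xe.1 = x.1 + Pi.single μ 1 → xe'.1 = x'.1 + Pi.single μ 1 → x'.1 ≠ x.1 →
          wsum2 δ₀ ((ℓ + 1) ^ k) x x' (fun z => ((((ℓ + 1) ^ k : ℕ) : ℝ) / supNorm (x'.1 - x.1)) ^ α *
              ((((ℓ + 1) ^ k : ℕ) : ℝ) * ((GfineL ℓ k M j a s xe' z - GfineL ℓ k M j a s x' z)
                - (GfineL ℓ k M j a s xe z - GfineL ℓ k M j a s x z)))) ≤ c₀ := by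
  obtain ⟨r, C₀, hr, hC₀, hdec⟩ := boxLine_L_inv_decay d ℓ (amin * (1 - ((((ℓ : ℝ) + 1)) ^ 2)⁻¹))
    aplus (aminus'_pos hℓ ha)
  obtain ⟨κ₀, Θ, hκ₀, hΘ, hstep⟩ := step_termH_bound_line d ℓ hℓ amin aplus ha hα0 hα1
  set δ₀ : ℝ := min (r / 2) κ₀ with hδ₀
  have hδ0 : 0 < δ₀ := lt_min (half_pos hr) hκ₀
  have hδr : δ₀ ≤ r / 2 := min_le_left _ _
  have hδκ : δ₀ ≤ κ₀ := min_le_right _ _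
  have hK1 := one_le_latticeConst d (half_pos hr)
  have hL0 : (0 : ℝ) < (ℓ : ℝ) + 1 := by positivity
  set B₁ : ℝ := 2 * (((ℓ : ℝ) + 1) ^ 2 * C₀ * (Real.exp r + 1) * latticeConst (d + 1) (r / 2)) with hB₁
  have hB₁0 : 0 < B₁ := by positivity
  set q : ℝ := ((ℓ : ℝ) + 1) ^ α * (((ℓ : ℝ) + 1))⁻¹ with hq
  have hq0 : 0 < q := by positivity
  have hq1' : q < 1 := Lratio_lt_one hℓ hα1
  have hq1 : 0 < 1 - q := by linarith
  have hΘe : 0 ≤ Θ * Real.exp δ₀ := by positivity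
  refine ⟨δ₀, B₁ + Θ * Real.exp δ₀ * (q / (1 - q)), hδ0,
    by linarith [mul_nonneg hΘe (div_nonneg hq0.le hq1.le)], ?_⟩
  intro k hk j hj1 hjk a s h1 h2 h3 h4 M hM
  have ha0 : 0 < a := lt_of_lt_of_le ha h1
  have hnk : 1 ≤ (ℓ + 1) ^ k := Nat.one_le_pow _ _ (by omega)
  have hn0 : (0 : ℝ) ≤ (((ℓ + 1) ^ k : ℕ) : ℝ) := Nat.cast_nonneg _
  -- the base: entries of `𝒢_1`, scaled by `(L^k)²`
  obtain ⟨hw1, hw2, hapos⟩ := aSeq_window hℓ ha h1 h2 (le_refl 1)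
  have hT : ∀ p q' : ↥(boxDom (Nf ℓ k M)),
      (((ℓ + 1) ^ k : ℕ) : ℝ) * ((((ℓ + 1) ^ k : ℕ) : ℝ) * |GfineL ℓ k M 1 a s p q'|)
        ≤ ((ℓ : ℝ) + 1) ^ 2 * C₀ * Real.exp (-(r * supNorm (p.1 - q'.1))) := by
    intro p q'
    rcases Nat.lt_or_ge k 2 with hk2 | hk2
    · obtain rfl : k = 1 := by omega
      rw [GfineL_top]
      have hd := hdec ((ℓ + 1) ^ 1) (Nat.one_le_pow 1 (ℓ + 1) (Nat.succ_pos ℓ)) (pow_one _) _ _ hw1 hw2 h3 h4 M p q'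
      have hc1 : (((ℓ + 1) ^ 1 : ℕ) : ℝ) = (ℓ : ℝ) + 1 := by push_cast; ring
      rw [hc1, ← mul_assoc, ← sq]
      exact (mul_le_mul_of_nonneg_left hd (by positivity)).trans (le_of_eq (by ring))
    · have hs : 0 < sc ℓ k 1 ^ 2 := pow_pos (sc_pos ℓ k 1) 2
      rw [GfineL_apply hℓ (le_refl 1) hk2 hM ha0 h3 h4 p q', abs_mul, abs_of_pos (inv_pos.2 hs), ← mul_assoc,
        ← mul_assoc, Lk_sq_mul_sc_one_sq_inv hk]
      have hd := hdec (bj ℓ 1) (bj_pos ℓ 1) (pow_one _) _ _ hw1 hw2 h3 h4 (Mj ℓ k M 1)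
        ((ej ℓ k M 1 hk2).symm p) ((ej ℓ k M 1 hk2).symm q')
      have hpv : ((ej ℓ k M 1 hk2).symm p).1 = p.1 := rfl
      have hqv : ((ej ℓ k M 1 hk2).symm q').1 = q'.1 := rfl
      rw [hpv, hqv] at hd
      exact (mul_le_mul_of_nonneg_left hd (by positivity)).trans (le_of_eq (by ring))
  -- the base: singly differenced rows against a weight `w ≤ L^k`
  have hTD : ∀ (μ : Fin (d + 1)) (x xe : ↥(boxDom (Nf ℓ k M))), xe.1 = x.1 + Pi.single μ 1 →
      ∀ w : ℝ, 0 ≤ w → w ≤ (((ℓ + 1) ^ k : ℕ) : ℝ) →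
      ∀ z : ↥(boxDom (Nf ℓ k M)),
        |w * ((((ℓ + 1) ^ k : ℕ) : ℝ) * (GfineL ℓ k M 1 a s xe z - GfineL ℓ k M 1 a s x z))|
          ≤ ((ℓ : ℝ) + 1) ^ 2 * C₀ * (Real.exp r + 1) * Real.exp (-(r * supNorm (x.1 - z.1))) := by
    intro μ x xe hxe w hw0 hwn z
    have h1' := hT xe z
    have h2' := hT x z
    have hnb := supNorm_sub_le_nbr (x' := z.1) hxe
    have he : Real.exp (-(r * supNorm (xe.1 - z.1)))
        ≤ Real.exp r * Real.exp (-(r * supNorm (x.1 - z.1))) := by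
      rw [← Real.exp_add]
      exact Real.exp_le_exp.2 (by nlinarith)
    have hLC : 0 ≤ ((ℓ : ℝ) + 1) ^ 2 * C₀ := by positivity
    calc |w * ((((ℓ + 1) ^ k : ℕ) : ℝ) * (GfineL ℓ k M 1 a s xe z - GfineL ℓ k M 1 a s x z))|
        = w * ((((ℓ + 1) ^ k : ℕ) : ℝ) * |GfineL ℓ k M 1 a s xe z - GfineL ℓ k M 1 a s x z|) := by
          rw [abs_mul, abs_mul, abs_of_nonneg hw0, abs_of_nonneg hn0]
      _ ≤ (((ℓ + 1) ^ k : ℕ) : ℝ) * ((((ℓ + 1) ^ k : ℕ) : ℝ) *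
            (|GfineL ℓ k M 1 a s xe z| + |GfineL ℓ k M 1 a s x z|)) :=
          mul_le_mul hwn (mul_le_mul_of_nonneg_left (abs_sub _ _) hn0) (by positivity) hn0
      _ = (((ℓ + 1) ^ k : ℕ) : ℝ) * ((((ℓ + 1) ^ k : ℕ) : ℝ) * |GfineL ℓ k M 1 a s xe z|)
            + (((ℓ + 1) ^ k : ℕ) : ℝ) * ((((ℓ + 1) ^ k : ℕ) : ℝ) * |GfineL ℓ k M 1 a s x z|) := by ring
      _ ≤ ((ℓ : ℝ) + 1) ^ 2 * C₀ * Real.exp (-(r * supNorm (xe.1 - z.1)))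
            + ((ℓ : ℝ) + 1) ^ 2 * C₀ * Real.exp (-(r * supNorm (x.1 - z.1))) := add_le_add h1' h2'
      _ ≤ ((ℓ : ℝ) + 1) ^ 2 * C₀ * (Real.exp r * Real.exp (-(r * supNorm (x.1 - z.1))))
            + ((ℓ : ℝ) + 1) ^ 2 * C₀ * Real.exp (-(r * supNorm (x.1 - z.1))) :=
          add_le_add (mul_le_mul_of_nonneg_left he hLC) le_rfl
      _ = _ := by ring
  -- the inductive claim
  have main : ∀ j, 1 ≤ j → j ≤ k → ∀ (μ : Fin (d + 1)) (x xe x' xe' : ↥(boxDom (Nf ℓ k M))),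
      xe.1 = x.1 + Pi.single μ 1 → xe'.1 = x'.1 + Pi.single μ 1 → x'.1 ≠ x.1 →
      wsum2 δ₀ ((ℓ + 1) ^ k) x x' (fun z => ((((ℓ + 1) ^ k : ℕ) : ℝ) / supNorm (x'.1 - x.1)) ^ α *
          ((((ℓ + 1) ^ k : ℕ) : ℝ) * ((GfineL ℓ k M j a s xe' z - GfineL ℓ k M j a s x' z)
            - (GfineL ℓ k M j a s xe z - GfineL ℓ k M j a s x z))))
        ≤ B₁ + Θ * Real.exp δ₀ * (q * (sc ℓ k j ^ α * (sc ℓ k j)⁻¹) / (1 - q)) := by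
    intro j hj1
    induction j, hj1 using Nat.le_induction with
    | base =>
      intro _ μ x xe x' xe' hxe hxe' hne
      have hσ1 : 1 ≤ supNorm (x'.1 - x.1) := one_le_supNorm (sub_ne_zero.2 hne)
      have hW0 : 0 ≤ ((((ℓ + 1) ^ k : ℕ) : ℝ) / supNorm (x'.1 - x.1)) ^ α :=
        Real.rpow_nonneg (div_nonneg hn0 (le_trans zero_le_one hσ1)) α
      have hWn := holderWeight_le hnk hσ1 hα0 hα1.le
      have hB0 : 0 ≤ ((ℓ : ℝ) + 1) ^ 2 * C₀ * (Real.exp r + 1) := by positivity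
      have hg₁ : ∀ z : ↥(boxDom (Nf ℓ k M)),
          |-(((((ℓ + 1) ^ k : ℕ) : ℝ) / supNorm (x'.1 - x.1)) ^ α *
              ((((ℓ + 1) ^ k : ℕ) : ℝ) * (GfineL ℓ k M 1 a s xe z - GfineL ℓ k M 1 a s x z)))|
            ≤ ((ℓ : ℝ) + 1) ^ 2 * C₀ * (Real.exp r + 1) * Real.exp (-(r * supNorm (x.1 - z.1))) := by
        intro z
        rw [abs_neg]
        exact hTD μ x xe hxe _ hW0 hWn z
      have hg₂ : ∀ z : ↥(boxDom (Nf ℓ k M)),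
          |((((ℓ + 1) ^ k : ℕ) : ℝ) / supNorm (x'.1 - x.1)) ^ α *
              ((((ℓ + 1) ^ k : ℕ) : ℝ) * (GfineL ℓ k M 1 a s xe' z - GfineL ℓ k M 1 a s x' z))|
            ≤ ((ℓ : ℝ) + 1) ^ 2 * C₀ * (Real.exp r + 1) * Real.exp (-(r * supNorm (x'.1 - z.1))) :=
        fun z => hTD μ x' xe' hxe' _ hW0 hWn z
      have hsplit := wsum2_split_le hδ0.le ((ℓ + 1) ^ k) x x'
        (fun z => ((((ℓ + 1) ^ k : ℕ) : ℝ) / supNorm (x'.1 - x.1)) ^ α *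
          ((((ℓ + 1) ^ k : ℕ) : ℝ) * ((GfineL ℓ k M 1 a s xe' z - GfineL ℓ k M 1 a s x' z)
            - (GfineL ℓ k M 1 a s xe z - GfineL ℓ k M 1 a s x z))))
        (fun z => -(((((ℓ + 1) ^ k : ℕ) : ℝ) / supNorm (x'.1 - x.1)) ^ α *
          ((((ℓ + 1) ^ k : ℕ) : ℝ) * (GfineL ℓ k M 1 a s xe z - GfineL ℓ k M 1 a s x z))))
        (fun z => ((((ℓ + 1) ^ k : ℕ) : ℝ) / supNorm (x'.1 - x.1)) ^ α *
          ((((ℓ + 1) ^ k : ℕ) : ℝ) * (GfineL ℓ k M 1 a s xe' z - GfineL ℓ k M 1 a s x' z)))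
        (fun z => by ring)
      have hpos : 0 ≤ Θ * Real.exp δ₀ * (q * (sc ℓ k 1 ^ α * (sc ℓ k 1)⁻¹) / (1 - q)) :=
        mul_nonneg hΘe (div_nonneg (mul_nonneg hq0.le (mul_nonneg (Real.rpow_nonneg (sc_pos ℓ k 1).le α)
          (inv_pos.2 (sc_pos ℓ k 1)).le)) hq1.le)
      calc _ ≤ _ := hsplit
        _ ≤ ((ℓ : ℝ) + 1) ^ 2 * C₀ * (Real.exp r + 1) * latticeConst (d + 1) (r / 2)
              + ((ℓ : ℝ) + 1) ^ 2 * C₀ * (Real.exp r + 1) * latticeConst (d + 1) (r / 2) :=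
            add_le_add (wsum_le_of_decay hnk x hB0 hr hδ0.le hδr hg₁)
              (wsum_le_of_decay hnk x' hB0 hr hδ0.le hδr hg₂)
        _ = B₁ := by rw [hB₁]; ring
        _ ≤ B₁ + Θ * Real.exp δ₀ * (q * (sc ℓ k 1 ^ α * (sc ℓ k 1)⁻¹) / (1 - q)) := by linarith
    | succ j hj1 ih =>
      intro hjk μ x xe x' xe' hxe hxe' hne
      have hprev := ih (by omega) μ x xe x' xe' hxe hxe' hne
      have hst := hstep δ₀ hδ0.le hδκ k j hj1 hjk a s h1 h2 h3 h4 M hM μ x xe x' xe' hxe hxe' hne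
      have hsplit : (fun z => ((((ℓ + 1) ^ k : ℕ) : ℝ) / supNorm (x'.1 - x.1)) ^ α *
            ((((ℓ + 1) ^ k : ℕ) : ℝ) * ((GfineL ℓ k M (j + 1) a s xe' z - GfineL ℓ k M (j + 1) a s x' z)
              - (GfineL ℓ k M (j + 1) a s xe z - GfineL ℓ k M (j + 1) a s x z))))
          = fun z => ((((ℓ + 1) ^ k : ℕ) : ℝ) / supNorm (x'.1 - x.1)) ^ α *
              ((((ℓ + 1) ^ k : ℕ) : ℝ) *
                (((GfineL ℓ k M (j + 1) a s - GfineL ℓ k M j a s) xe' z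
                    - (GfineL ℓ k M (j + 1) a s - GfineL ℓ k M j a s) x' z)
                  - ((GfineL ℓ k M (j + 1) a s - GfineL ℓ k M j a s) xe z
                    - (GfineL ℓ k M (j + 1) a s - GfineL ℓ k M j a s) x z)))
            + ((((ℓ + 1) ^ k : ℕ) : ℝ) / supNorm (x'.1 - x.1)) ^ α *
              ((((ℓ + 1) ^ k : ℕ) : ℝ) * ((GfineL ℓ k M j a s xe' z - GfineL ℓ k M j a s x' z)
                - (GfineL ℓ k M j a s xe z - GfineL ℓ k M j a s x z))) := by
        funext z
        simp only [Matrix.sub_apply]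
        ring
      rw [hsplit]
      calc _ ≤ _ := wsum2_add_le _ _ _ _ _ _
        _ ≤ Θ * Real.exp δ₀ * (sc ℓ k j ^ α * (sc ℓ k j)⁻¹)
              + (B₁ + Θ * Real.exp δ₀ * (q * (sc ℓ k j ^ α * (sc ℓ k j)⁻¹) / (1 - q))) :=
            add_le_add hst hprev
        _ = B₁ + Θ * Real.exp δ₀ * (q * (sc ℓ k (j + 1) ^ α * (sc ℓ k (j + 1))⁻¹) / (1 - q)) := by
            rw [sc_rpow_mul_inv_succ hjk α, ← hq]
            field_simp
            ring
  intro μ x xe x' xe' hxe hxe' hne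
  have hm := main j hj1 hjk μ x xe x' xe' hxe hxe' hne
  have hs1 : sc ℓ k j ^ α * (sc ℓ k j)⁻¹ ≤ 1 := sc_rpow_mul_inv_le_one ℓ k j hα1.le
  have hgeo : q * (sc ℓ k j ^ α * (sc ℓ k j)⁻¹) / (1 - q) ≤ q / (1 - q) :=
    div_le_div_of_nonneg_right (mul_le_of_le_one_right hq0.le hs1) hq1.le
  have hfin := mul_le_mul_of_nonneg_left hgeo hΘe
  linarith

/-! ### §2 THEOREM (1.9) of [B4] FOR THE TWO-CUTOFF LINE on boxes: the Hölder quotient of `∂^η_μG^Π_k(s)` (two-centre weighted-row form) -/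

/-- **[B4] p. 573 THEOREM (Proposition 2.1 of [1]), inequality (1.9) — the HÖLDER CLAUSE — FOR THE TWO-CUTOFF LINE at `A = 0`
on RECTANGULAR PARALLELEPIPEDS** (two-centre weighted-row form): for every `0 ≤ α < 1` there are `δ₀ > 0`, `c₀ > 0` depending only on
`d`, `L = ℓ + 1`, `α` and the window `[a₋,a₊]` such that for every `k ≥ 1` (`η = L^{-k}`), every `a` in the window, EVERY `s ∈ [0,1]`,
every box `□ = Π_μ[0, M_μ)` (`M_μ ≥ 1`), every axis `μ` and all `x ≠ x′` in `□ ∩ ηℤ^{d+1}` with `xe = x + ηe_μ`, `xe′ = x′ + ηe_μ` in `□`: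
`Σ_{z ∈ □} (η|x′−x|_∞)^{-α}·|η^{-1}((G(xe′,z) − G(x′,z)) − (G(xe,z) − G(x,z)))|·e^{δ₀·min(dist(x,z), dist(x′,z))} ≤ c₀`,
`G = G^Π_k(s) = (boxLine(L^k, M, a_k, s))⁻¹ = (T^Π(s) + a_kQ_k^*Q_k)⁻¹` the line's propagator on the Neumann box (values form),
`dist = |·|_∞/L^k`.  HONEST LABEL: the LINE is not in [B4]; proved by the print's box route (2.34)/(2.36)/(2.38)–(2.39) transposed to the
line (files 94–103), from file 79's (2.36) for the line.
[cite: Balaban1983RegularityDecay, p. 573 Theorem (1.9); p. 582 (2.34), Lemma 2.4 (2.36), (2.38); p. 583 (2.39), for the two-cutoff line] -/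
theorem thm19_line_box_holder_roww (d ℓ : ℕ) (hℓ : 1 ≤ ℓ) (amin aplus : ℝ) (ha : 0 < amin) (α : ℝ)
    (hα0 : 0 ≤ α) (hα1 : α < 1) :
    ∃ δ₀ c₀ : ℝ, 0 < δ₀ ∧ 0 < c₀ ∧ ∀ (k : ℕ), 1 ≤ k → ∀ (a s : ℝ), amin ≤ a → a ≤ aplus → 0 ≤ s →
      s ≤ 1 → ∀ (M : Fin (d + 1) → ℕ), (∀ i, 1 ≤ M i) →
        ∀ (μ : Fin (d + 1)) (x xe x' xe' : ↥(boxDom (fun i => (ℓ + 1) ^ k * M i))),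
          xe.1 = x.1 + Pi.single μ 1 → xe'.1 = x'.1 + Pi.single μ 1 → x'.1 ≠ x.1 →
          ∑ z, |((((ℓ + 1) ^ k : ℕ) : ℝ) / supNorm (x'.1 - x.1)) ^ α * ((((ℓ + 1) ^ k : ℕ) : ℝ) *
                (((boxLine (ℓ + 1) (Nat.one_le_pow k (ℓ + 1) (Nat.succ_pos ℓ)) M (B1.aSeq a ((ℓ : ℝ) + 1) k) s)⁻¹ xe' z
                    - (boxLine (ℓ + 1) (Nat.one_le_pow k (ℓ + 1) (Nat.succ_pos ℓ)) M (B1.aSeq a ((ℓ : ℝ) + 1) k) s)⁻¹ x' z)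
                  - ((boxLine (ℓ + 1) (Nat.one_le_pow k (ℓ + 1) (Nat.succ_pos ℓ)) M (B1.aSeq a ((ℓ : ℝ) + 1) k) s)⁻¹ xe z
                    - (boxLine (ℓ + 1) (Nat.one_le_pow k (ℓ + 1) (Nat.succ_pos ℓ)) M (B1.aSeq a ((ℓ : ℝ) + 1) k) s)⁻¹ x z)))|
              * Real.exp (δ₀ * min (supNorm (x.1 - z.1)) (supNorm (x'.1 - z.1)) / (((ℓ + 1) ^ k : ℕ) : ℝ))
            ≤ c₀ := by
  obtain ⟨δ₀, c₀, hδ, hc, h⟩ := GfineL_rowwH_bound d ℓ hℓ amin aplus ha hα0 hα1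
  refine ⟨δ₀, c₀, hδ, hc, fun k hk a s h1 h2 h3 h4 M hM μ x xe x' xe' hxe hxe' hne => ?_⟩
  have hG : GfineL ℓ k M k a s = (boxLine (ℓ + 1) (Nat.one_le_pow k (ℓ + 1) (Nat.succ_pos ℓ)) M (B1.aSeq a ((ℓ : ℝ) + 1) k) s)⁻¹ :=
    GfineL_top ℓ k M a s
  have := h k hk k hk le_rfl a s h1 h2 h3 h4 M hM μ x xe x' xe' hxe hxe' hne
  rw [wsum2, hG] at this
  exact this

end Summit.QuantumFields.BalabanUV.T4Continuum.NE7K1LinBoxThm19Holder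

end
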